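import Summits.Ventures.Crystal3D.Theorems.StickyWulffConstantCoaxialWallLawPayerFamilyEndsExcl
import Summits.Ventures.Crystal3D.Theorems.StickyWulffConstantCoaxialWallLawEndUniqueMulti
import HarnessLib

/-!
# End accounting, census-free, multi-source II‴: the pooled end pairs with a ROOT-INDEXED state invariant, exported

HONEST FRAMING. Part of the venture `Summits/Ventures/Crystal3D` (cell `crystal3d-full`), helper for the crux
`CoaxialWallLaw` (stmt-Ventures-19481) of `route-Ventures-StickyWulffConstant`, REGISTERED line `WallLedgerF`
(planner cf-p1), open stub `stub_coaxialTwoSlabAdhesion` (general fillings).  Rung credit only; F-C1 not moved.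
Memo HOME/wall-19481-p2/F-NEXT-SPEC.md §S1-STATUS (19481-p2 g4: «plane-coset class needs a ROOT-INDEXED invariant
`P r` version of `…PayerEndPairsMulti`»).  The text of `word_endPairs_multiExcl_inv` (`…PayerEndPairsMulti`) with the
single shared state invariant `P` replaced by a family of invariants `P r`, one per root `r ∈ RT` (each family's words
carry their own invariant; the hypotheses `hPfull`/`hPcross`/`hPexcl0`/`hPsrc` are asked root by root), and with the two
exported existentials MERGED: every pooled pair `(b, q) ∈ T` comes with ONE root `r ∈ RT` carrying BOTH a well-formed
word `κ` with `P r (b, κ)` AND a LEMMA-X-format reading witness of the same family.  This is the form the PLANE-COSET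
translation cell needs (invariant «letters ⊥ s_r, `⟪G₀⁻¹(b − s₁), s_r⟫ ∈ ½ℤ`» with the τ-skew partner slot `s_r` of
the root), where bottom/top pairs of the SAME root are separated by the invariant and pairs of DIFFERENT roots by
LEMMA X (`word_target_ne_of_roots_ne`, `…EndUniqueMulti`).

`Σ_{r ∈ RT} #sources_r ≤ #T + #RT·(220·#rim_top + 220·#rim_bottom)`.

WHAT THIS IS NOT: not the stub; not a cell; F-C1 not moved.
-/
noncomputable section

namespace Summit.Ventures.Crystal3D.Theorems

open Summit.Ventures.Crystal3D Finset
open Literature.MathematicalPhysics.StatisticalMechanics (fccStacking)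
open scoped InnerProductSpace

section MultiRoot

variable {X : Finset (EuclideanSpace ℝ (Fin 3))}
  {F : List (EuclideanSpace ℝ (Fin 3)) → (EuclideanSpace ℝ (Fin 3) ≃ₗᵢ[ℝ] EuclideanSpace ℝ (Fin 3))}
  {u : EuclideanSpace ℝ (Fin 3) → List (EuclideanSpace ℝ (Fin 3)) → EuclideanSpace ℝ (Fin 3)}
  {WF : EuclideanSpace ℝ (Fin 3) → List (EuclideanSpace ℝ (Fin 3)) → Prop}
  {next : List (EuclideanSpace ℝ (Fin 3)) → EuclideanSpace ℝ (Fin 3) → List (EuclideanSpace ℝ (Fin 3))}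
  {P₁ P' P₂ : Finset (EuclideanSpace ℝ (Fin 3))} {t₁ t₂ : EuclideanSpace ℝ (Fin 3)} {R₀ h ρ : ℝ}

open scoped Classical in
/-- **The multi-root census-free count with a ROOT-INDEXED state invariant, exported.**  See the module
docstring. -/
theorem word_endPairs_multiExcl_invRoot {δ : ℝ} (hg : KissingGap δ) (hc : KissingClassification δ)
    (hX : ∀ p ∈ X, ∀ q ∈ X, p ≠ q → 1 ≤ dist p q)
    (hFc : ∀ μ κ, F (μ :: κ) = ((ℝ ∙ μ)ᗮ.reflection).trans (F κ))
    (RT : Finset (EuclideanSpace ℝ (Fin 3))) (hRT : ∀ r ∈ RT, r ∈ fccSlots)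
    (hu0 : ∀ r ∈ RT, u r [] = r) (huc : ∀ r ∈ RT, ∀ μ κ, u r (μ :: κ) = -u r κ)
    (hWF0 : ∀ r ∈ RT, WF r [])
    (hWFc : ∀ r ∈ RT, ∀ μ κ, WF r (μ :: κ) ↔ (WF r κ ∧ ‖μ‖ = 1 ∧
      (∀ w ∈ fccSlots, ⟪w, μ⟫_ℝ = 0 ∨ ⟪w, μ⟫_ℝ = Real.sqrt (2 / 3) ∨ ⟪w, μ⟫_ℝ = -Real.sqrt (2 / 3)) ∧
      ⟪u r κ, μ⟫_ℝ = Real.sqrt (2 / 3) ∧ ∀ μ' κ', κ = μ' :: κ' → μ' ≠ -μ))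
    (hnext_pop : ∀ μ κ' (m : EuclideanSpace ℝ (Fin 3)), (F (μ :: κ')).symm m = -μ → next (μ :: κ') m = κ')
    (hnext_push : ∀ κ (m : EuclideanSpace ℝ (Fin 3)), (∀ μ κ', κ = μ :: κ' → (F κ).symm m ≠ -μ) →
      next κ m = (F κ).symm m :: κ)
    -- the top grain's frame and the root-indexed state invariants
    (G₂ : EuclideanSpace ℝ (Fin 3) ≃ₗᵢ[ℝ] EuclideanSpace ℝ (Fin 3))
    {P : EuclideanSpace ℝ (Fin 3) → EuclideanSpace ℝ (Fin 3) × List (EuclideanSpace ℝ (Fin 3)) → Prop}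
    (hPfull : ∀ r ∈ RT, ∀ (b : EuclideanSpace ℝ (Fin 3)) (κ : List (EuclideanSpace ℝ (Fin 3))), WF r κ →
      P r (b, κ) → P r (b + F κ (u r κ), κ))
    (hPcross : ∀ r ∈ RT, ∀ (b : EuclideanSpace ℝ (Fin 3)) (κ : List (EuclideanSpace ℝ (Fin 3))) (m : EuclideanSpace ℝ (Fin 3)),
      WF r κ → WF r (next κ m) → P r (b, κ) → P r (b + F (next κ m) (u r (next κ m)), next κ m))
    (hPexcl0 : ∀ r ∈ RT, ∀ (b : EuclideanSpace ℝ (Fin 3)) (κ : List (EuclideanSpace ℝ (Fin 3))), WF r κ → P r (b, κ) →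
      b ∈ P₂ → (∀ w ∈ fccSlots, b + G₂ w ∈ X) →
      (∃ a ∈ fccSlots, ∃ a' ∈ fccSlots, ∃ a'' ∈ fccSlots,
        ⟪a, a'⟫_ℝ = 1 / 2 ∧ ⟪a, a''⟫_ℝ = 1 / 2 ∧ ⟪a', a''⟫_ℝ = 1 / 2 ∧
        b + F κ a ∈ X ∧ b + F κ a' ∈ X ∧ b + F κ a'' ∈ X) → False)
    (hup : ∀ r ∈ RT, 0 < (F [] r) 2)
    -- the cell
    (hR₀ : 3 ≤ R₀) (hρ : R₀ ≤ ρ)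
    (hcell : ∀ p ∈ X, -(2 * R₀) ≤ p 2 ∧ p 2 ≤ h + 2 * R₀ ∧ p 0 ^ 2 + p 1 ^ 2 ≤ ρ ^ 2)
    (hP₁X : P₁ ⊆ X) (hP₂X : P₂ ⊆ X)
    (hP₁ : ∀ p, p ∈ P₁ ↔ (p ∈ (fun q => F [] q + t₁) '' fccStacking 1 (Real.sqrt (2 / 3)) ∧
      -(2 * R₀) ≤ p 2 ∧ p 2 ≤ -R₀ ∧ p 0 ^ 2 + p 1 ^ 2 ≤ ρ ^ 2))
    (hP' : ∀ p, p ∈ P' ↔ (p ∈ (fun q => F [] q + t₁) '' fccStacking 1 (Real.sqrt (2 / 3)) ∧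
      -(2 * R₀) + 1 ≤ p 2 ∧ p 2 ≤ -R₀ - 1 ∧ p 0 ^ 2 + p 1 ^ 2 ≤ (ρ - 1) ^ 2))
    (hP'full : ∀ p ∈ P', ∀ w ∈ fccSlots, p + F [] w ∈ X)
    (hPsrc : ∀ r ∈ RT, ∀ p ∈ P', P r (p + F [] r, []))
    (hP₂ : ∀ p, p ∈ P₂ ↔ (p ∈ (fun q => G₂ q + t₂) '' fccStacking 1 (Real.sqrt (2 / 3)) ∧
      h + R₀ ≤ p 2 ∧ p 2 ≤ h + 2 * R₀ ∧ p 0 ^ 2 + p 1 ^ 2 ≤ ρ ^ 2)) :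
    ∃ T : Finset (EuclideanSpace ℝ (Fin 3) × EuclideanSpace ℝ (Fin 3)),
      ∑ r ∈ RT, (P'.filter fun p => (∀ w ∈ fccSlots, p + F [] w ∈ X) ∧
          -R₀ - 1 < (p + F [] r) 2 ∧ (p + F [] r) 2 < h + R₀ + 1).card ≤
        T.card + RT.card *
          (220 * (X.filter fun s => h + R₀ + 1 ≤ s 2 ∧ s 2 ≤ h + R₀ + 1 + 1 ∧ (ρ - 2) ^ 2 < s 0 ^ 2 + s 1 ^ 2).card +
           220 * (X.filter fun s => -R₀ - 1 - 1 ≤ s 2 ∧ s 2 < -R₀ - 1 ∧ (ρ - 1) ^ 2 < s 0 ^ 2 + s 1 ^ 2).card) ∧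
      (∀ bq ∈ T, bq.1 ∈ X ∧ bq.2 ∈ X ∧ dist bq.1 bq.2 = 1 ∧ -R₀ - 1 ≤ bq.1 2 ∧ bq.1 2 < h + R₀ + 1) ∧
      (∀ bq ∈ T, (X.filter fun q => dist bq.1 q = 1).card ≤ 11 ∨
        ∃ z₁ ∈ X, ∃ z₂ ∈ X, z₁ ≠ z₂ ∧ dist bq.1 z₁ = 1 ∧ dist bq.1 z₂ = 1 ∧
          (X.filter fun q => dist z₁ q = 1).card ≤ 11 ∧ (X.filter fun q => dist z₂ q = 1).card ≤ 11) ∧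
      (∀ bq ∈ T, ∃ r ∈ RT, (∃ κ, WF r κ ∧ P r (bq.1, κ)) ∧ ∃ κ, WF r κ ∧
        (((∀ w ∈ fccSlots, bq.2 + F κ w ∈ X) ∧ bq.1 = bq.2 + F κ (u r κ)) ∨
          ∃ m : EuclideanSpace ℝ (Fin 3), ‖m‖ = 1 ∧
            (∀ w ∈ fccSlots, ⟪F κ w, m⟫_ℝ = 0 ∨ ⟪F κ w, m⟫_ℝ = Real.sqrt (2 / 3) ∨ ⟪F κ w, m⟫_ℝ = -Real.sqrt (2 / 3)) ∧
            (∀ w ∈ fccSlots, ⟪F κ w, m⟫_ℝ ≤ 0 → bq.2 + F κ w ∈ X) ∧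
            (∀ w ∈ fccSlots, ⟪F κ w, m⟫_ℝ < 0 → bq.2 + (F κ w - (2 * ⟪F κ w, m⟫_ℝ) • m) ∈ X) ∧
            (∀ w ∈ fccSlots, 0 < ⟪F κ w, m⟫_ℝ → bq.2 + F κ w ∉ X) ∧
            ((⟪F κ (u r κ), m⟫_ℝ = Real.sqrt (2 / 3) ∧ bq.1 = bq.2 - (F κ (u r κ) - (2 * ⟪F κ (u r κ), m⟫_ℝ) • m)) ∨
              (⟪F κ (u r κ), m⟫_ℝ = 0 ∧ bq.1 = bq.2 + F κ (u r κ))))) := by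
  set RIM : ℕ :=
    220 * (X.filter fun s => h + R₀ + 1 ≤ s 2 ∧ s 2 ≤ h + R₀ + 1 + 1 ∧ (ρ - 2) ^ 2 < s 0 ^ 2 + s 1 ^ 2).card +
      220 * (X.filter fun s => -R₀ - 1 - 1 ≤ s 2 ∧ s 2 < -R₀ - 1 ∧ (ρ - 1) ^ 2 < s 0 ^ 2 + s 1 ^ 2).card with hRIM
  -- the per-family end pairs, each family with its own invariant `P r`
  have hfam : ∀ r ∈ RT, ∃ T : Finset (EuclideanSpace ℝ (Fin 3) × EuclideanSpace ℝ (Fin 3)),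
      (P'.filter fun p => (∀ w ∈ fccSlots, p + F [] w ∈ X) ∧
          -R₀ - 1 < (p + F [] r) 2 ∧ (p + F [] r) 2 < h + R₀ + 1).card ≤ T.card + RIM ∧
      (∀ bq ∈ T, bq.1 ∈ X ∧ bq.2 ∈ X ∧ dist bq.1 bq.2 = 1 ∧ -R₀ - 1 ≤ bq.1 2 ∧ bq.1 2 < h + R₀ + 1) ∧
      (∀ bq ∈ T, (X.filter fun q => dist bq.1 q = 1).card ≤ 11 ∨
        ∃ z₁ ∈ X, ∃ z₂ ∈ X, z₁ ≠ z₂ ∧ dist bq.1 z₁ = 1 ∧ dist bq.1 z₂ = 1 ∧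
          (X.filter fun q => dist z₁ q = 1).card ≤ 11 ∧ (X.filter fun q => dist z₂ q = 1).card ≤ 11) ∧
      (∀ bq ∈ T, ∃ κ, WF r κ ∧ P r (bq.1, κ)) ∧
      (∀ bq ∈ T, ∃ κ, WF r κ ∧
        (((∀ w ∈ fccSlots, bq.2 + F κ w ∈ X) ∧ bq.1 = bq.2 + F κ (u r κ)) ∨
          ∃ m : EuclideanSpace ℝ (Fin 3), ‖m‖ = 1 ∧
            (∀ w ∈ fccSlots, ⟪F κ w, m⟫_ℝ = 0 ∨ ⟪F κ w, m⟫_ℝ = Real.sqrt (2 / 3) ∨ ⟪F κ w, m⟫_ℝ = -Real.sqrt (2 / 3)) ∧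
            (∀ w ∈ fccSlots, ⟪F κ w, m⟫_ℝ ≤ 0 → bq.2 + F κ w ∈ X) ∧
            (∀ w ∈ fccSlots, ⟪F κ w, m⟫_ℝ < 0 → bq.2 + (F κ w - (2 * ⟪F κ w, m⟫_ℝ) • m) ∈ X) ∧
            (∀ w ∈ fccSlots, 0 < ⟪F κ w, m⟫_ℝ → bq.2 + F κ w ∉ X) ∧
            ((⟪F κ (u r κ), m⟫_ℝ = Real.sqrt (2 / 3) ∧ bq.1 = bq.2 - (F κ (u r κ) - (2 * ⟪F κ (u r κ), m⟫_ℝ) • m)) ∨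
              (⟪F κ (u r κ), m⟫_ℝ = 0 ∧ bq.1 = bq.2 + F κ (u r κ))))) := by
    intro r hr
    have hur : ∀ κ, u r κ ∈ fccSlots := word_u_mem (hRT r hr) (hu0 r hr) (huc r hr)
    have hup' : 0 < (F [] (u r [])) 2 := by rw [hu0 r hr]; exact hup r hr
    have hPsrc' : ∀ p ∈ P', P r (p + F [] (u r []), []) := by rw [hu0 r hr]; exact hPsrc r hr
    obtain ⟨T, hkey, hT, hpay, hinv, hwit⟩ := word_family_endPairs_excl (F := F) (u := u r) (WF := WF r)
      (next := next) (t₁ := t₁) (t₂ := t₂) (P := P r) hg hc hX hFc hur (huc r hr) (hWF0 r hr) (hWFc r hr)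
      hnext_pop hnext_push G₂ (hPfull r hr) (hPcross r hr) (hPexcl0 r hr) hup' hR₀ hρ hcell hP₁X hP₂X hP₁ hP'
      hP'full hPsrc' hP₂
    rw [hu0 r hr] at hkey
    exact ⟨T, by rw [hRIM]; linarith [hkey], hT, hpay, hinv, hwit⟩
  choose! Tf hTkey hTpair hTpay hTinv hTwit using hfam
  -- pairwise disjointness across roots: LEMMA X
  have hdisj : ∀ r ∈ RT, ∀ r' ∈ RT, r ≠ r' → Disjoint (Tf r) (Tf r') := by
    intro r hr r' hr' hrr'
    rw [Finset.disjoint_left]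
    intro bq hbq hbq'
    obtain ⟨κ, hκ, hpat⟩ := hTwit r hr bq hbq
    obtain ⟨κ', hκ', hpat'⟩ := hTwit r' hr' bq hbq'
    obtain ⟨hlet, hch⟩ := word_letters_of_wf (huc r hr) (hWFc r hr) κ hκ
    obtain ⟨hlet', hch'⟩ := word_letters_of_wf (huc r' hr') (hWFc r' hr') κ' hκ'
    have hne' : r ≠ -r' := by
      intro h
      have h1 := hup r hr
      have h2 := hup r' hr'
      rw [h, map_neg, PiLp.neg_apply] at h1
      linarith
    have hd : F κ (u r κ) = F κ (((-1 : ℝ) ^ κ.length) • r) := by rw [word_u_eq_pow (huc r hr) κ, hu0 r hr]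
    have hd' : F κ' (u r' κ') = F κ' (((-1 : ℝ) ^ κ'.length) • r') := by
      rw [word_u_eq_pow (huc r' hr') κ', hu0 r' hr']
    exact word_target_ne_of_roots_ne hX hFc hlet hlet' hch hch' (hRT r hr) (hRT r' hr') hrr' hne' hd hd' hpat hpat' rfl
  -- export the pooled pair set
  refine ⟨RT.biUnion Tf, ?_, ?_, ?_, ?_⟩
  · rw [card_biUnion hdisj]
    calc ∑ r ∈ RT, (P'.filter fun p => (∀ w ∈ fccSlots, p + F [] w ∈ X) ∧
            -R₀ - 1 < (p + F [] r) 2 ∧ (p + F [] r) 2 < h + R₀ + 1).card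
        ≤ ∑ r ∈ RT, ((Tf r).card + RIM) := sum_le_sum fun r hr => hTkey r hr
      _ = ∑ r ∈ RT, (Tf r).card + RT.card * RIM := by rw [sum_add_distrib, sum_const, smul_eq_mul]
      _ ≤ _ := by rw [hRIM]
  · intro bq hbq
    obtain ⟨r, hr, hbqr⟩ := mem_biUnion.1 hbq
    exact hTpair r hr bq hbqr
  · intro bq hbq
    obtain ⟨r, hr, hbqr⟩ := mem_biUnion.1 hbq
    exact hTpay r hr bq hbqr
  · intro bq hbq
    obtain ⟨r, hr, hbqr⟩ := mem_biUnion.1 hbq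
    exact ⟨r, hr, hTinv r hr bq hbqr, hTwit r hr bq hbqr⟩

end MultiRoot

end Summit.Ventures.Crystal3D.Theorems

end
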